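import Summits.ValiantsHypothesis.ValiantsHypothesis.Theorems.LiftNullstellensatzLiftWidthPerFourCaseAZero
import Summits.ValiantsHypothesis.ValiantsHypothesis.Theorems.LiftNullstellensatzLiftWidthPerFourOuterLayersDefs
import Summits.ValiantsHypothesis.ValiantsHypothesis.Theorems.LiftNullstellensatzLiftWidthPerFourCaseARows

/-!
# Route LiftNullstellensatz — `LiftWidthPerFour` (stmt-ValiantsHypothesis-5922): CASE A from the
uniform target `(V⁺)`

`(V⁺)(ℓ,ℓ')` (crux workfile `Cruxes/LiftWidthPerFour/STAGED-CERT-p1g2.md` §7, target of record for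
`stub_caseA` per director-valiant 2026-08-27): with `X̂ := (ℓ, x_{i₀,0..3})`, `Ξ̂ := (ℓ', x_{i₁,0..3})`,
`𝔪_X := (X̂)`, `𝔪_Ξ := (Ξ̂)` and `𝔫 := 𝔪_X · 𝔪_Ξ · (𝔪_X + 𝔪_Ξ)²`, for all `5 × 5` matrices `L₂, L₃` of
linear forms, `per_4 − X̂ᵀ L₂ L₃ Ξ̂ ∉ 𝔫` ("stages 1 ∧ 2 of the Taylor tower are infeasible").
Since `0 ∈ 𝔫`, `(V⁺)` for all `(i₀ ≠ i₁, ℓ, ℓ')` implies `stub_caseA` of line `outer_layers`; this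
file proves that implication (`stub_caseA_of_vplus`), the bookkeeping being the passage from
quadrics `v_s ∈ (x_{i₀,·}, ℓ)₂` to a matrix of LINEAR forms (`exists_linear_coeffs_of_mem_span`,
via `homogeneousComponent_mul_of_isHomogeneous_one`) and padding to five products.  The
hypothesis is written out in full (the named `Prop` lives in the route's Defs file).
No new definitions.  VP ≠ VNP is not moved by this item.
-/

noncomputable section

open MvPolynomial

namespace Summit.ValiantsHypothesis.LiftNullstellensatz

open Literature.Computability.AlgebraicComplexity

variable {K : Type*} [Field K] {σ : Type*}

/-- `homogeneousComponent (n+1) (g * m) = homogeneousComponent n g * m` for a linear form `m`.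
[folklore] -/
theorem homogeneousComponent_mul_of_isHomogeneous_one {m : MvPolynomial σ K} (hm : m.IsHomogeneous 1)
    (g : MvPolynomial σ K) (n : ℕ) :
    homogeneousComponent (n + 1) (g * m) = homogeneousComponent n g * m := by
  classical
  conv_lhs => rw [← sum_homogeneousComponent g]
  rw [Finset.sum_mul, map_sum]
  have key : ∀ i, homogeneousComponent (n + 1) (homogeneousComponent i g * m) =
      if i = n then homogeneousComponent n g * m else 0 := by
    intro i
    have hmem : homogeneousComponent i g * m ∈ homogeneousSubmodule σ K (i + 1) :=
      (homogeneousComponent_isHomogeneous i g).mul hm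
    rw [homogeneousComponent_of_mem hmem]
    by_cases hin : i = n
    · subst hin; simp
    · have : n + 1 ≠ i + 1 := fun h => hin (by omega)
      rw [if_neg this, if_neg hin]
  rw [Finset.sum_congr rfl fun i _ => key i, Finset.sum_ite_eq']
  split_ifs with h
  · rfl
  · rw [Finset.mem_range, not_lt] at h
    rw [homogeneousComponent_eq_zero n g (by omega), zero_mul]

/-- A homogeneous quadric in the ideal of finitely many linear forms `f i` is `Σ f i * c i` with
LINEAR `c i`. [folklore] -/
theorem exists_linear_coeffs_of_mem_span {ι : Type*} [Fintype ι] (f : ι → MvPolynomial σ K)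
    (hf : ∀ i, (f i).IsHomogeneous 1) {v : MvPolynomial σ K} (hv : v.IsHomogeneous 2)
    (hmem : v ∈ Ideal.span (Set.range f)) :
    ∃ c : ι → MvPolynomial σ K, (∀ i, (c i).IsHomogeneous 1) ∧ v = ∑ i, f i * c i := by
  classical
  obtain ⟨c, hc⟩ := Ideal.mem_span_range_iff_exists_fun.1 hmem
  refine ⟨fun i => homogeneousComponent 1 (c i), fun i => homogeneousComponent_isHomogeneous _ _, ?_⟩
  calc v = homogeneousComponent 2 v := (homogeneousComponent_eq_self hv).symm
    _ = ∑ i, homogeneousComponent 1 (c i) * f i := by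
        rw [← hc, map_sum]
        exact Finset.sum_congr rfl fun i _ => homogeneousComponent_mul_of_isHomogeneous_one (hf i) _ 1
    _ = ∑ i, f i * homogeneousComponent 1 (c i) := Finset.sum_congr rfl fun i _ => mul_comm _ _

/-- **`stub_caseA` from `(V⁺)`.**  If for all rows `i₀ ≠ i₁`, all linear forms `ℓ, ℓ'` and all
`5 × 5` matrices `L₂, L₃` of linear forms `per_4 − X̂ᵀ L₂ L₃ Ξ̂ ∉ 𝔪_X 𝔪_Ξ (𝔪_X + 𝔪_Ξ)²`
(`X̂ = Fin.cons ℓ (x_{i₀,·})`, `Ξ̂ = Fin.cons ℓ' (x_{i₁,·})`), then `stub_caseA` of line `outer_layers`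
holds (an exact ABP would put `per_4 − X̂ᵀL₂L₃Ξ̂ = 0` into the ideal).
[cite: BlaserIkenmeyerMahajanPandeySaurabh2020, §2 (problem)] -/
theorem stub_caseA_of_vplus
    (H : ∀ i₀ i₁ : Fin 4, i₀ ≠ i₁ → ∀ ℓ ℓ' : MvPolynomial (Fin 4 × Fin 4) ℂ,
      ℓ.IsHomogeneous 1 → ℓ'.IsHomogeneous 1 →
      ∀ L₂ L₃ : Fin 5 → Fin 5 → MvPolynomial (Fin 4 × Fin 4) ℂ,
      (∀ j s, (L₂ j s).IsHomogeneous 1) → (∀ s k, (L₃ s k).IsHomogeneous 1) →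
      perPoly (Fin 4) ℂ - ∑ j, ∑ s, ∑ k,
          (Fin.cons ℓ (fun j : Fin 4 => (X (i₀, j) : MvPolynomial (Fin 4 × Fin 4) ℂ)) : Fin 5 → _) j *
          L₂ j s * L₃ s k *
          (Fin.cons ℓ' (fun k : Fin 4 => (X (i₁, k) : MvPolynomial (Fin 4 × Fin 4) ℂ)) : Fin 5 → _) k ∉
        Ideal.span (Set.range (Fin.cons ℓ (fun j : Fin 4 => (X (i₀, j) : MvPolynomial (Fin 4 × Fin 4) ℂ))
            : Fin 5 → _)) *
        Ideal.span (Set.range (Fin.cons ℓ' (fun k : Fin 4 => (X (i₁, k) : MvPolynomial (Fin 4 × Fin 4) ℂ))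
            : Fin 5 → _)) *
        (Ideal.span (Set.range (Fin.cons ℓ (fun j : Fin 4 => (X (i₀, j) : MvPolynomial (Fin 4 × Fin 4) ℂ))
            : Fin 5 → _)) ⊔
         Ideal.span (Set.range (Fin.cons ℓ' (fun k : Fin 4 => (X (i₁, k) : MvPolynomial (Fin 4 × Fin 4) ℂ))
            : Fin 5 → _))) ^ 2) :
    ∀ b : ℕ, b ≤ 5 → ∀ i₀ i₁ : Fin 4, i₀ ≠ i₁ →
      ∀ ℓ ℓ' : MvPolynomial (Fin 4 × Fin 4) ℂ, ℓ.IsHomogeneous 1 → ℓ'.IsHomogeneous 1 →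
      ∀ v v' : Fin b → MvPolynomial (Fin 4 × Fin 4) ℂ,
        (∀ s, v s ∈ Ideal.span (insert ℓ (Set.range fun j : Fin 4 =>
          (X (i₀, j) : MvPolynomial (Fin 4 × Fin 4) ℂ)))) →
        (∀ s, (v s).IsHomogeneous 2) →
        (∀ s, v' s ∈ Ideal.span (insert ℓ' (Set.range fun j : Fin 4 =>
          (X (i₁, j) : MvPolynomial (Fin 4 × Fin 4) ℂ)))) →
        (∀ s, (v' s).IsHomogeneous 2) →
        perPoly (Fin 4) ℂ ≠ ∑ s, v s * v' s := by
  classical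
  intro b hb i₀ i₁ hi ℓ ℓ' hℓ hℓ' v v' hv hv2 hv' hv'2 hper
  set Xh : Fin 5 → MvPolynomial (Fin 4 × Fin 4) ℂ :=
    Fin.cons ℓ (fun j : Fin 4 => (X (i₀, j) : MvPolynomial (Fin 4 × Fin 4) ℂ)) with hXh
  set Ξh : Fin 5 → MvPolynomial (Fin 4 × Fin 4) ℂ :=
    Fin.cons ℓ' (fun k : Fin 4 => (X (i₁, k) : MvPolynomial (Fin 4 × Fin 4) ℂ)) with hΞh
  have hXh1 : ∀ j, (Xh j).IsHomogeneous 1 := fun j => by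
    refine Fin.cases ?_ (fun j => ?_) j
    · simpa [hXh] using hℓ
    · simpa [hXh] using isHomogeneous_X ℂ (i₀, j)
  have hΞh1 : ∀ k, (Ξh k).IsHomogeneous 1 := fun k => by
    refine Fin.cases ?_ (fun k => ?_) k
    · simpa [hΞh] using hℓ'
    · simpa [hΞh] using isHomogeneous_X ℂ (i₁, k)
  have hrange : Set.range Xh = insert ℓ (Set.range fun j : Fin 4 =>
      (X (i₀, j) : MvPolynomial (Fin 4 × Fin 4) ℂ)) := by rw [hXh, Fin.range_cons]
  have hrange' : Set.range Ξh = insert ℓ' (Set.range fun j : Fin 4 =>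
      (X (i₁, j) : MvPolynomial (Fin 4 × Fin 4) ℂ)) := by rw [hΞh, Fin.range_cons]
  -- linear coefficient vectors of the quadrics
  have hc : ∀ s, ∃ c : Fin 5 → MvPolynomial (Fin 4 × Fin 4) ℂ,
      (∀ j, (c j).IsHomogeneous 1) ∧ v s = ∑ j, Xh j * c j := fun s =>
    exists_linear_coeffs_of_mem_span Xh hXh1 (hv2 s) (by rw [hrange]; exact hv s)
  have hc' : ∀ s, ∃ c : Fin 5 → MvPolynomial (Fin 4 × Fin 4) ℂ,
      (∀ k, (c k).IsHomogeneous 1) ∧ v' s = ∑ k, Ξh k * c k := fun s =>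
    exists_linear_coeffs_of_mem_span Ξh hΞh1 (hv'2 s) (by rw [hrange']; exact hv' s)
  choose c hc1 hcv using hc
  choose c' hc'1 hc'v using hc'
  -- the padded matrices of linear forms
  let L₂ : Fin 5 → Fin 5 → MvPolynomial (Fin 4 × Fin 4) ℂ := fun j t =>
    if h : (t : ℕ) < b then c ⟨t, h⟩ j else 0
  let L₃ : Fin 5 → Fin 5 → MvPolynomial (Fin 4 × Fin 4) ℂ := fun t k =>
    if h : (t : ℕ) < b then c' ⟨t, h⟩ k else 0
  have hL₂ : ∀ j t, (L₂ j t).IsHomogeneous 1 := fun j t => by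
    simp only [L₂]; split_ifs
    · exact hc1 _ _
    · exact isHomogeneous_zero _ _ _
  have hL₃ : ∀ t k, (L₃ t k).IsHomogeneous 1 := fun t k => by
    simp only [L₃]; split_ifs
    · exact hc'1 _ _
    · exact isHomogeneous_zero _ _ _
  -- the ABP equals Σ v_s v'_s
  have habp : ∑ j, ∑ t, ∑ k, Xh j * L₂ j t * L₃ t k * Ξh k = ∑ s, v s * v' s := by
    have step1 : ∑ j, ∑ t, ∑ k, Xh j * L₂ j t * L₃ t k * Ξh k =
        ∑ t, (∑ j, Xh j * L₂ j t) * (∑ k, Ξh k * L₃ t k) := by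
      rw [Finset.sum_comm]
      refine Finset.sum_congr rfl fun t _ => ?_
      rw [Finset.sum_mul_sum]
      refine Finset.sum_congr rfl fun j _ => Finset.sum_congr rfl fun k _ => ?_
      ring
    rw [step1]
    -- compare with the padded products
    let f : ℕ → MvPolynomial (Fin 4 × Fin 4) ℂ := fun n =>
      if h : n < b then v ⟨n, h⟩ * v' ⟨n, h⟩ else 0
    have h5 : ∑ t : Fin 5, (∑ j, Xh j * L₂ j t) * (∑ k, Ξh k * L₃ t k) =
        ∑ n ∈ Finset.range 5, f n := by
      rw [← Fin.sum_univ_eq_sum_range]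
      refine Finset.sum_congr rfl fun t _ => ?_
      simp only [L₂, L₃, f]
      by_cases h : (t : ℕ) < b
      · simp only [dif_pos h]; rw [← hcv, ← hc'v]
      · simp only [dif_neg h, mul_zero, Finset.sum_const_zero]
    have hb' : ∑ s : Fin b, v s * v' s = ∑ n ∈ Finset.range b, f n := by
      rw [← Fin.sum_univ_eq_sum_range]
      refine Finset.sum_congr rfl fun s _ => ?_
      simp only [f, dif_pos s.isLt]
    rw [h5, hb']
    refine (Finset.sum_subset (Finset.range_subset_range.2 hb) fun n hn hnb => ?_).symm
    simp only [f, Finset.mem_range] at hnb ⊢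
    rw [dif_neg hnb]
  refine H i₀ i₁ hi ℓ ℓ' hℓ hℓ' L₂ L₃ hL₂ hL₃ ?_
  rw [habp, ← hper, sub_self]
  exact Ideal.zero_mem _

/-- **Case A for a FIXED pair of rows from `(V⁺)` for that pair** (the form used by the line's
skeleton together with the reduction to the rows `(0, 3)`, `caseA_of_caseA_rows_zero_three`): if for
all linear `ℓ, ℓ'` and all `5 × 5` matrices of linear forms `per_4 − X̂ᵀ L₂ L₃ Ξ̂ ∉ 𝔪_X 𝔪_Ξ (𝔪_X + 𝔪_Ξ)²`
(`X̂ = Fin.cons ℓ (x_{i₀,·})`, `Ξ̂ = Fin.cons ℓ' (x_{i₁,·})`), then `per_4` is not a sum of `b ≤ 5`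
products of quadrics `v_s ∈ (x_{i₀,·}, ℓ)`, `v'_s ∈ (x_{i₁,·}, ℓ')`.  Same bookkeeping as
`stub_caseA_of_vplus`. [cite: BlaserIkenmeyerMahajanPandeySaurabh2020, §2 (problem)] -/
theorem caseA_rows_of_vplus (i₀ i₁ : Fin 4)
    (H : ∀ ℓ ℓ' : MvPolynomial (Fin 4 × Fin 4) ℂ,
      ℓ.IsHomogeneous 1 → ℓ'.IsHomogeneous 1 →
      ∀ L₂ L₃ : Fin 5 → Fin 5 → MvPolynomial (Fin 4 × Fin 4) ℂ,
      (∀ j s, (L₂ j s).IsHomogeneous 1) → (∀ s k, (L₃ s k).IsHomogeneous 1) →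
      perPoly (Fin 4) ℂ - ∑ j, ∑ s, ∑ k,
          (Fin.cons ℓ (fun j : Fin 4 => (X (i₀, j) : MvPolynomial (Fin 4 × Fin 4) ℂ)) : Fin 5 → _) j *
          L₂ j s * L₃ s k *
          (Fin.cons ℓ' (fun k : Fin 4 => (X (i₁, k) : MvPolynomial (Fin 4 × Fin 4) ℂ)) : Fin 5 → _) k ∉
        Ideal.span (Set.range (Fin.cons ℓ (fun j : Fin 4 => (X (i₀, j) : MvPolynomial (Fin 4 × Fin 4) ℂ))
            : Fin 5 → _)) *
        Ideal.span (Set.range (Fin.cons ℓ' (fun k : Fin 4 => (X (i₁, k) : MvPolynomial (Fin 4 × Fin 4) ℂ))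
            : Fin 5 → _)) *
        (Ideal.span (Set.range (Fin.cons ℓ (fun j : Fin 4 => (X (i₀, j) : MvPolynomial (Fin 4 × Fin 4) ℂ))
            : Fin 5 → _)) ⊔
         Ideal.span (Set.range (Fin.cons ℓ' (fun k : Fin 4 => (X (i₁, k) : MvPolynomial (Fin 4 × Fin 4) ℂ))
            : Fin 5 → _))) ^ 2) :
    ∀ b : ℕ, b ≤ 5 →
      ∀ ℓ ℓ' : MvPolynomial (Fin 4 × Fin 4) ℂ, ℓ.IsHomogeneous 1 → ℓ'.IsHomogeneous 1 →
      ∀ v v' : Fin b → MvPolynomial (Fin 4 × Fin 4) ℂ,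
        (∀ s, v s ∈ Ideal.span (insert ℓ (Set.range fun j : Fin 4 =>
          (X (i₀, j) : MvPolynomial (Fin 4 × Fin 4) ℂ)))) →
        (∀ s, (v s).IsHomogeneous 2) →
        (∀ s, v' s ∈ Ideal.span (insert ℓ' (Set.range fun j : Fin 4 =>
          (X (i₁, j) : MvPolynomial (Fin 4 × Fin 4) ℂ)))) →
        (∀ s, (v' s).IsHomogeneous 2) →
        perPoly (Fin 4) ℂ ≠ ∑ s, v s * v' s := by
  classical
  intro b hb ℓ ℓ' hℓ hℓ' v v' hv hv2 hv' hv'2 hper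
  set Xh : Fin 5 → MvPolynomial (Fin 4 × Fin 4) ℂ :=
    Fin.cons ℓ (fun j : Fin 4 => (X (i₀, j) : MvPolynomial (Fin 4 × Fin 4) ℂ)) with hXh
  set Ξh : Fin 5 → MvPolynomial (Fin 4 × Fin 4) ℂ :=
    Fin.cons ℓ' (fun k : Fin 4 => (X (i₁, k) : MvPolynomial (Fin 4 × Fin 4) ℂ)) with hΞh
  have hXh1 : ∀ j, (Xh j).IsHomogeneous 1 := fun j => by
    refine Fin.cases ?_ (fun j => ?_) j
    · simpa [hXh] using hℓ
    · simpa [hXh] using isHomogeneous_X ℂ (i₀, j)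
  have hΞh1 : ∀ k, (Ξh k).IsHomogeneous 1 := fun k => by
    refine Fin.cases ?_ (fun k => ?_) k
    · simpa [hΞh] using hℓ'
    · simpa [hΞh] using isHomogeneous_X ℂ (i₁, k)
  have hrange : Set.range Xh = insert ℓ (Set.range fun j : Fin 4 =>
      (X (i₀, j) : MvPolynomial (Fin 4 × Fin 4) ℂ)) := by rw [hXh, Fin.range_cons]
  have hrange' : Set.range Ξh = insert ℓ' (Set.range fun j : Fin 4 =>
      (X (i₁, j) : MvPolynomial (Fin 4 × Fin 4) ℂ)) := by rw [hΞh, Fin.range_cons]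
  -- linear coefficient vectors of the quadrics
  have hc : ∀ s, ∃ c : Fin 5 → MvPolynomial (Fin 4 × Fin 4) ℂ,
      (∀ j, (c j).IsHomogeneous 1) ∧ v s = ∑ j, Xh j * c j := fun s =>
    exists_linear_coeffs_of_mem_span Xh hXh1 (hv2 s) (by rw [hrange]; exact hv s)
  have hc' : ∀ s, ∃ c : Fin 5 → MvPolynomial (Fin 4 × Fin 4) ℂ,
      (∀ k, (c k).IsHomogeneous 1) ∧ v' s = ∑ k, Ξh k * c k := fun s =>
    exists_linear_coeffs_of_mem_span Ξh hΞh1 (hv'2 s) (by rw [hrange']; exact hv' s)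
  choose c hc1 hcv using hc
  choose c' hc'1 hc'v using hc'
  -- the padded matrices of linear forms
  let L₂ : Fin 5 → Fin 5 → MvPolynomial (Fin 4 × Fin 4) ℂ := fun j t =>
    if h : (t : ℕ) < b then c ⟨t, h⟩ j else 0
  let L₃ : Fin 5 → Fin 5 → MvPolynomial (Fin 4 × Fin 4) ℂ := fun t k =>
    if h : (t : ℕ) < b then c' ⟨t, h⟩ k else 0
  have hL₂ : ∀ j t, (L₂ j t).IsHomogeneous 1 := fun j t => by
    simp only [L₂]; split_ifs
    · exact hc1 _ _
    · exact isHomogeneous_zero _ _ _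
  have hL₃ : ∀ t k, (L₃ t k).IsHomogeneous 1 := fun t k => by
    simp only [L₃]; split_ifs
    · exact hc'1 _ _
    · exact isHomogeneous_zero _ _ _
  -- the ABP equals Σ v_s v'_s
  have habp : ∑ j, ∑ t, ∑ k, Xh j * L₂ j t * L₃ t k * Ξh k = ∑ s, v s * v' s := by
    have step1 : ∑ j, ∑ t, ∑ k, Xh j * L₂ j t * L₃ t k * Ξh k =
        ∑ t, (∑ j, Xh j * L₂ j t) * (∑ k, Ξh k * L₃ t k) := by
      rw [Finset.sum_comm]
      refine Finset.sum_congr rfl fun t _ => ?_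
      rw [Finset.sum_mul_sum]
      refine Finset.sum_congr rfl fun j _ => Finset.sum_congr rfl fun k _ => ?_
      ring
    rw [step1]
    -- compare with the padded products
    let f : ℕ → MvPolynomial (Fin 4 × Fin 4) ℂ := fun n =>
      if h : n < b then v ⟨n, h⟩ * v' ⟨n, h⟩ else 0
    have h5 : ∑ t : Fin 5, (∑ j, Xh j * L₂ j t) * (∑ k, Ξh k * L₃ t k) =
        ∑ n ∈ Finset.range 5, f n := by
      rw [← Fin.sum_univ_eq_sum_range]
      refine Finset.sum_congr rfl fun t _ => ?_
      simp only [L₂, L₃, f]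
      by_cases h : (t : ℕ) < b
      · simp only [dif_pos h]; rw [← hcv, ← hc'v]
      · simp only [dif_neg h, mul_zero, Finset.sum_const_zero]
    have hb' : ∑ s : Fin b, v s * v' s = ∑ n ∈ Finset.range b, f n := by
      rw [← Fin.sum_univ_eq_sum_range]
      refine Finset.sum_congr rfl fun s _ => ?_
      simp only [f, dif_pos s.isLt]
    rw [h5, hb']
    refine (Finset.sum_subset (Finset.range_subset_range.2 hb) fun n hn hnb => ?_).symm
    simp only [f, Finset.mem_range] at hnb ⊢
    rw [dif_neg hnb]
  refine H ℓ ℓ' hℓ hℓ' L₂ L₃ hL₂ hL₃ ?_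
  rw [habp, ← hper, sub_self]
  exact Ideal.zero_mem _


/-- **Case A for a fixed pair of rows from the NAMED target `CaseAVPlus`** (Defs file
`…OuterLayersDefs.lean`): `(∀ ℓ ℓ' linear, CaseAVPlus i₀ i₁ ℓ ℓ')` ⇒ no width-`5` outer-row program
for the rows `(i₀, i₁)`.  Definitional unfolding of `caseA_rows_of_vplus`. [folklore] -/
theorem caseA_rows_of_caseAVPlus (i₀ i₁ : Fin 4)
    (H : ∀ ℓ ℓ' : MvPolynomial (Fin 4 × Fin 4) ℂ, ℓ.IsHomogeneous 1 → ℓ'.IsHomogeneous 1 →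
      CaseAVPlus i₀ i₁ ℓ ℓ') :
    ∀ b : ℕ, b ≤ 5 →
      ∀ ℓ ℓ' : MvPolynomial (Fin 4 × Fin 4) ℂ, ℓ.IsHomogeneous 1 → ℓ'.IsHomogeneous 1 →
      ∀ v v' : Fin b → MvPolynomial (Fin 4 × Fin 4) ℂ,
        (∀ s, v s ∈ Ideal.span (insert ℓ (Set.range fun j : Fin 4 =>
          (X (i₀, j) : MvPolynomial (Fin 4 × Fin 4) ℂ)))) →
        (∀ s, (v s).IsHomogeneous 2) →
        (∀ s, v' s ∈ Ideal.span (insert ℓ' (Set.range fun j : Fin 4 =>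
          (X (i₁, j) : MvPolynomial (Fin 4 × Fin 4) ℂ)))) →
        (∀ s, (v' s).IsHomogeneous 2) →
        perPoly (Fin 4) ℂ ≠ ∑ s, v s * v' s :=
  caseA_rows_of_vplus i₀ i₁ fun ℓ ℓ' hℓ hℓ' => H ℓ ℓ' hℓ hℓ'

/-- **`stub_caseA` from the NAMED target**: `(∀ i₀ ≠ i₁, ∀ ℓ ℓ' linear, CaseAVPlus i₀ i₁ ℓ ℓ')` implies
the registered stub `stub_caseA` of line `outer_layers`. [folklore] -/
theorem stub_caseA_of_caseAVPlus
    (H : ∀ i₀ i₁ : Fin 4, i₀ ≠ i₁ → ∀ ℓ ℓ' : MvPolynomial (Fin 4 × Fin 4) ℂ,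
      ℓ.IsHomogeneous 1 → ℓ'.IsHomogeneous 1 → CaseAVPlus i₀ i₁ ℓ ℓ') :
    ∀ b : ℕ, b ≤ 5 → ∀ i₀ i₁ : Fin 4, i₀ ≠ i₁ →
      ∀ ℓ ℓ' : MvPolynomial (Fin 4 × Fin 4) ℂ, ℓ.IsHomogeneous 1 → ℓ'.IsHomogeneous 1 →
      ∀ v v' : Fin b → MvPolynomial (Fin 4 × Fin 4) ℂ,
        (∀ s, v s ∈ Ideal.span (insert ℓ (Set.range fun j : Fin 4 =>
          (X (i₀, j) : MvPolynomial (Fin 4 × Fin 4) ℂ)))) →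
        (∀ s, (v s).IsHomogeneous 2) →
        (∀ s, v' s ∈ Ideal.span (insert ℓ' (Set.range fun j : Fin 4 =>
          (X (i₁, j) : MvPolynomial (Fin 4 × Fin 4) ℂ)))) →
        (∀ s, (v' s).IsHomogeneous 2) →
        perPoly (Fin 4) ℂ ≠ ∑ s, v s * v' s :=
  fun b hb i₀ i₁ hi => caseA_rows_of_caseAVPlus i₀ i₁ (H i₀ i₁ hi) b hb

/-- **The single open stub in named form closes CASE A**: `(V⁺)` for the rows `(0,3)` and all linear
`ℓ, ℓ'` implies `stub_caseA` (row reduction `caseA_of_caseA_rows_zero_three`). [folklore] -/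
theorem stub_caseA_of_caseAVPlus_zero_three
    (H : ∀ ℓ ℓ' : MvPolynomial (Fin 4 × Fin 4) ℂ, ℓ.IsHomogeneous 1 → ℓ'.IsHomogeneous 1 →
      CaseAVPlus 0 3 ℓ ℓ') :
    ∀ b : ℕ, b ≤ 5 → ∀ i₀ i₁ : Fin 4, i₀ ≠ i₁ →
      ∀ ℓ ℓ' : MvPolynomial (Fin 4 × Fin 4) ℂ, ℓ.IsHomogeneous 1 → ℓ'.IsHomogeneous 1 →
      ∀ v v' : Fin b → MvPolynomial (Fin 4 × Fin 4) ℂ,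
        (∀ s, v s ∈ Ideal.span (insert ℓ (Set.range fun j : Fin 4 =>
          (X (i₀, j) : MvPolynomial (Fin 4 × Fin 4) ℂ)))) →
        (∀ s, (v s).IsHomogeneous 2) →
        (∀ s, v' s ∈ Ideal.span (insert ℓ' (Set.range fun j : Fin 4 =>
          (X (i₁, j) : MvPolynomial (Fin 4 × Fin 4) ℂ)))) →
        (∀ s, (v' s).IsHomogeneous 2) →
        perPoly (Fin 4) ℂ ≠ ∑ s, v s * v' s :=
  caseA_of_caseA_rows_zero_three (caseA_rows_of_caseAVPlus 0 3 H)

end Summit.ValiantsHypothesis.LiftNullstellensatz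

end
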